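import Literature.Probability.LatticeModels.MeanFieldBoundGHS
import HarnessLib

/-!
# `ε(Λ_n,β,h) → 0`: the correcting term of Duminil-Copin–Tassion's Lemma 2.6 vanishes (proved)

Topic `Probability/LatticeModels`, namespace `Literature.Probability.LatticeModels`. This file
**discharges the named fact `dct_boundaryError_tendsto_zero`** of `MeanFieldLowerBound.lean`
(`dct_boundaryError_tendsto_zero_holds`): for the nearest-neighbour Ising model on `ℤ^d`,
`d ≥ 1`, `β > 0` and `h > 0` (Duminil-Copin–Tassion's parametrisation, `dctCorr`), the
correcting term of the Correction CMP 359 (2018) 821 to Lemma 2.6 of CMP 343 (2016) 725,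

  `ε(Λ,β,h) = 2 ∑_{x ∈ Λ} ∑_{y ∉ Λ} J_{x,y} (⟨σ₀σ_x⟩_{Λ,β,h} - ⟨σ₀⟩_{Λ,β,h}⟨σ_x⟩_{Λ,β,h})`

(`dctBoundaryError`), tends to `0` along the boxes `Λ_n = [-n,n]^d`. The Correction only says
"the GHS inequality [GHS70] classically implies that `ε(Λ,β,h)` tends to `0` as `Λ` tends to
`V`"; the classical argument written out here is the following (tree parametrisation of the
field, `k = h/β`, so that DCT's `h` is the tree's `βk`).

## The argument

Let `Λ₁ ⊆ Λ` be finite volumes of a locally finite graph, `a ∈ Λ₁`, `β, k ≥ 0`, and switch the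
magnetic field of the sites of `Λ ∖ Λ₁` on linearly: `Φ(t) = ⟨σ_a⟩_t` for the free Hamiltonian of
`Λ` with field `βk` on `Λ₁` and `tβk` on `Λ ∖ Λ₁`, `t ∈ [0, 1]` (the path `cplAt K B t` of
`LebowitzInequality` with `B` the one-body terms of `Λ ∖ Λ₁`). Then

* `Φ'(t) = βk ∑_{x ∈ Λ∖Λ₁} ⟨σ_a;σ_x⟩_t` (`hasDerivAt_gksExpect_cplAt_cov_single`), and by the
  **GHS inequality** each truncated two-point function is nonincreasing along the path
  (`antitoneOn_gksTrunc_cplAt`: Lebowitz 1974, Remark (ii), "`⟨q_A⟩` is a decreasing function of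
  the external fields"), so `Φ` is concave and `Φ'(1) ≤ Φ(1) - Φ(0)`
  (`sum_mul_gksTrunc_le_gksExpect_sub_cplOff`, the lower companion of
  `MeanFieldBoundGHS.gksExpect_spinAt_sub_cplOff_le`);
* `Φ(1) = ⟨σ_a⟩^∅_{Λ;β,k}` and, by Griffiths' comparison of couplings
  (`gksExpect_mono_of_abs_le`) with the decoupled system of `Λ₁`
  (`isingCorr_free_eq_gksExpect_decoupled`, Friedli–Velenik 2017, Exercise 3.12),
  `Φ(0) ≥ ⟨σ_a⟩^∅_{Λ₁;β,k}`.

Hence (`mul_sum_trunc_sdiff_le_isingCorr_sub`)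

  `βk ∑_{x ∈ Λ∖Λ₁} ⟨σ_a;σ_x⟩^∅_{Λ;β,k} ≤ ⟨σ_a⟩^∅_{Λ;β,k} - ⟨σ_a⟩^∅_{Λ₁;β,k}`.

On `ℤ^d` with `Λ = Λ_{n+1}`, `Λ₁ = Λ_n`, `a = 0`: the sites of `Λ_n` have all their neighbours in
`Λ_{n+1}`, each site has at most `2d` neighbours, and the truncated functions are nonnegative
(GKS II), so `0 ≤ ε(Λ_{n+1},β,h) ≤ (4d/h)(⟨σ₀⟩_{Λ_{n+1},β,h} - ⟨σ₀⟩_{Λ_n,β,h})`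
(`dctBoundaryError_box_succ_le`), and the right side tends to `0` because the finite-volume
magnetisations converge (existence of the free state, `tendsto_dctMag_box`).

## References

* H. Duminil-Copin, V. Tassion, CMP 343 (2016) 725, Lemma 2.6; Correction, CMP 359 (2018)
  821–822 (definition of `ε(Λ,β,h)`; "the GHS inequality classically implies that `ε(Λ,β,h)`
  tends to `0`") [DuminilCopinTassionCMP2016].
* R. B. Griffiths, C. A. Hurst, S. Sherman, J. Math. Phys. 11 (1970) 790 (GHS inequality)
  [GriffithsHurstSherman1970]; J. L. Lebowitz, *GHS and other inequalities*, CMP 35 (1974) 87,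
  Remark (ii) [Lebowitz1974].
* S. Friedli, Y. Velenik, *Statistical Mechanics of Lattice Systems* (CUP 2017), §3.8.1 and
  Exercises 3.12, 3.31 [FriedliVelenik2017].
-/

noncomputable section

open Finset Filter Topology MeasureTheory Set
open scoped symmDiff

namespace Literature.Probability.LatticeModels

/-! ## The GHS interpolation bound at the far end of the path -/

section GKS

variable {Λ : Type*} [Fintype Λ] [DecidableEq Λ] {ι : Type*} [DecidableEq ι]
variable (s : Finset ι) (K : ι → ℝ) (C : ι → Finset Λ) (B : Finset ι) (p : ι → Λ)

/-- **The GHS interpolation bound, lower form**: for `Kᵢ ≥ 0` on supports of at most two sites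
and a set `B` of one-body terms `Kᵢ σ_{pᵢ}`,
`∑_{i ∈ B} Kᵢ (⟨σ_aσ_{pᵢ}⟩ - ⟨σ_a⟩⟨σ_{pᵢ}⟩)_K ≤ ⟨σ_a⟩_K - ⟨σ_a⟩_{K off B}`:
`t ↦ ⟨σ_a⟩_{cplAt K B t}` has the nonincreasing derivative `∑_{i∈B} Kᵢ ⟨σ_a; σ_{pᵢ}⟩_t`
(`antitoneOn_gksTrunc_cplAt`, the GHS inequality), so its increment over `[0, 1]` is at least
the derivative at `t = 1` (mean value inequality). Companion of
`gksExpect_spinAt_sub_cplOff_le` (increment at most the derivative at `t = 0`); together they are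
the concavity of the magnetisation in nonnegative fields (Lebowitz 1974, Remark (ii):
"`⟨q_A⟩` is a decreasing function of the external fields"). [cite: Lebowitz1974, §2, Remark (ii) following the proof of the Theorem] -/
theorem sum_mul_gksTrunc_le_gksExpect_sub_cplOff (hK : ∀ i ∈ s, 0 ≤ K i)
    (hC : ∀ i ∈ s, (C i).card ≤ 2) (hBs : B ⊆ s) (hB : ∀ i ∈ B, C i = {p i}) (a : Λ) :
    ∑ i ∈ B, K i * (gksExpect s K C (fun ω => spinAt a ω * spinAt (p i) ω) -
        gksExpect s K C (spinAt a) * gksExpect s K C (spinAt (p i))) ≤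
      gksExpect s K C (spinAt a) - gksExpect s (cplOff K B) C (spinAt a) := by
  set M := ∑ i ∈ B, K i * (gksExpect s K C (fun ω => spinAt a ω * spinAt (p i) ω) -
    gksExpect s K C (spinAt a) * gksExpect s K C (spinAt (p i))) with hM
  set Φ : ℝ → ℝ := fun t => gksExpect s (cplAt K B t) C (spinAt a) with hΦ
  have hder : ∀ t, HasDerivAt Φ (∑ i ∈ B, K i *
      (gksExpect s (cplAt K B t) C (fun ω => spinAt a ω * spinAt (p i) ω) -
        gksExpect s (cplAt K B t) C (spinAt a) * gksExpect s (cplAt K B t) C (spinAt (p i)))) t :=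
    fun t => hasDerivAt_gksExpect_cplAt_cov_single s K C B p hBs hB (spinAt a) t
  -- the derivative is nonincreasing on `[0, ∞)`, hence at least its value `M` at `t = 1` on `[0, 1]`
  have hbound : ∀ t, 0 ≤ t → t ≤ 1 → M ≤ ∑ i ∈ B, K i *
      (gksExpect s (cplAt K B t) C (fun ω => spinAt a ω * spinAt (p i) ω) -
        gksExpect s (cplAt K B t) C (spinAt a) * gksExpect s (cplAt K B t) C (spinAt (p i))) := by
    intro t ht0 ht1
    refine Finset.sum_le_sum fun i hi => mul_le_mul_of_nonneg_left ?_ (hK i (hBs hi))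
    have h := antitoneOn_gksTrunc_cplAt s K C B p hK hC hBs hB a (p i) (Set.mem_Ici.2 ht0)
      (Set.mem_Ici.2 (zero_le_one : (0 : ℝ) ≤ 1)) ht1
    simpa only [cplAt_one] using h
  have hdiff : Differentiable ℝ Φ := fun t => (hder t).differentiableAt
  have hderiv_ge : ∀ t ∈ interior (Set.Icc (0 : ℝ) 1), M ≤ deriv Φ t := by
    intro t ht
    rw [interior_Icc] at ht
    rw [(hder t).deriv]
    exact hbound t ht.1.le ht.2.le
  have hmvt := (convex_Icc (0 : ℝ) 1).mul_sub_le_image_sub_of_le_deriv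
    hdiff.continuous.continuousOn hdiff.differentiableOn hderiv_ge 0
    (Set.left_mem_Icc.2 zero_le_one) 1 (Set.right_mem_Icc.2 zero_le_one) zero_le_one
  have h1 : Φ 1 = gksExpect s K C (spinAt a) := by simp only [hΦ, cplAt_one]
  have h0 : Φ 0 = gksExpect s (cplOff K B) C (spinAt a) := by simp only [hΦ, cplAt_zero]
  rw [h1, h0, sub_zero, mul_one] at hmvt
  exact hmvt

end GKS

/-! ## The finite-volume Ising model: lowering the field on part of the volume -/

section Ising

variable {V : Type*} [DecidableEq V] (G : SimpleGraph V) [G.LocallyFinite]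

/-- **GHS bound on the truncated two-point functions of a sub-volume's complement.** On a
locally finite graph, for finite volumes `Λ₁ ⊆ Λ`, `β ≥ 0`, `h ≥ 0` (tree parametrisation: the
field enters as `βh`) and `a ∈ Λ₁`:
`βh ∑_{x ∈ Λ ∖ Λ₁} (⟨σ_aσ_x⟩ - ⟨σ_a⟩⟨σ_x⟩)^∅_{Λ;β,h} ≤ ⟨σ_a⟩^∅_{Λ;β,h} - ⟨σ_a⟩^∅_{Λ₁;β,h}`.
Switch the field of the sites of `Λ ∖ Λ₁` on linearly: by GHS the magnetisation at `a` is concave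
along the path, so its total increment dominates the final slope
(`sum_mul_gksTrunc_le_gksExpect_sub_cplOff`); at the start of the path (no field on `Λ ∖ Λ₁`) the
couplings still dominate those of the decoupled free system of `Λ₁`, so the magnetisation there is
at least `⟨σ_a⟩^∅_{Λ₁;β,h}` (Griffiths' comparison, Friedli–Velenik 2017, Exercises 3.12 and 3.31). [cite: Lebowitz1974, §2, Remark (ii) following the proof of the Theorem] [cite: FriedliVelenik2017, Exercises 3.12 and 3.31, pp. 112, 142] -/
theorem mul_sum_trunc_sdiff_le_isingCorr_sub {Λ₁ Λ : Finset V} (h1 : Λ₁ ⊆ Λ) {β h : ℝ}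
    (hβ : 0 ≤ β) (hh : 0 ≤ h) {a : V} (ha : a ∈ Λ₁) :
    β * h * ∑ x ∈ Λ \ Λ₁, (isingCorr G Λ β h .free ({a} ∆ {x}) -
        isingCorr G Λ β h .free {a} * isingCorr G Λ β h .free {x}) ≤
      isingCorr G Λ β h .free {a} - isingCorr G Λ₁ β h .free {a} := by
  classical
  have haΛ : a ∈ Λ := h1 ha
  set s := isingIdx G Λ with hs
  set K := gksCoupling G Λ β h .free with hKdef
  set C := isingSupp Λ with hCdef
  set B : Finset (Sym2 V ⊕ V) := (Λ \ Λ₁).map Function.Embedding.inr with hB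
  set p : Sym2 V ⊕ V → ↥Λ := fun i =>
    Sum.elim (fun _ => (⟨a, haΛ⟩ : ↥Λ)) (fun x => if hx : x ∈ Λ then ⟨x, hx⟩ else ⟨a, haΛ⟩) i
    with hp
  have hmemB : ∀ {i : Sym2 V ⊕ V}, i ∈ B ↔ ∃ x ∈ Λ \ Λ₁, Sum.inr x = i := by
    intro i
    simp only [hB, Finset.mem_map, Function.Embedding.inr_apply]
  have hBs : B ⊆ s := by
    intro i hi
    obtain ⟨x, hx, rfl⟩ := hmemB.1 hi
    rw [hs, isingIdx, Finset.inr_mem_disjSum]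
    exact (Finset.mem_sdiff.1 hx).1
  have hK : ∀ i ∈ s, 0 ≤ K i := gksCoupling_nonneg G hβ hh (Or.inl rfl)
  have hC : ∀ i ∈ s, (C i).card ≤ 2 := fun i _ => card_isingSupp_le_two Λ i
  have hp_inr : ∀ {x : V} (hx : x ∈ Λ), p (Sum.inr x) = ⟨x, hx⟩ := by
    intro x hx
    simp only [hp, Sum.elim_inr, dif_pos hx]
  have hBC : ∀ i ∈ B, C i = {p i} := by
    intro i hi
    obtain ⟨x, hx, rfl⟩ := hmemB.1 hi
    have hxΛ : x ∈ Λ := (Finset.mem_sdiff.1 hx).1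
    rw [hp_inr hxΛ]
    ext w
    simp only [hCdef, isingSupp, Finset.mem_filter, Finset.mem_univ, true_and,
      Finset.mem_singleton, Subtype.ext_iff]
  -- the abstract bound
  have hmain := sum_mul_gksTrunc_le_gksExpect_sub_cplOff s K C B p hK hC hBs hBC ⟨a, haΛ⟩
  -- identify the left side
  have hl : ∑ i ∈ B, K i *
      (gksExpect s K C (fun ω => spinAt (⟨a, haΛ⟩ : ↥Λ) ω * spinAt (p i) ω) -
        gksExpect s K C (spinAt (⟨a, haΛ⟩ : ↥Λ)) * gksExpect s K C (spinAt (p i))) =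
      β * h * ∑ x ∈ Λ \ Λ₁, (isingCorr G Λ β h .free ({a} ∆ {x}) -
        isingCorr G Λ β h .free {a} * isingCorr G Λ β h .free {x}) := by
    rw [hB, Finset.sum_map, Finset.mul_sum]
    refine Finset.sum_congr rfl fun x hx => ?_
    have hxΛ : x ∈ Λ := (Finset.mem_sdiff.1 hx).1
    rw [Function.Embedding.inr_apply, hp_inr hxΛ, ← isingCorr_pair_eq_gksExpect G Λ β h .free haΛ hxΛ,
      ← isingCorr_singleton_eq_gksExpect G Λ β h .free haΛ,
      ← isingCorr_singleton_eq_gksExpect G Λ β h .free hxΛ]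
    simp only [hKdef, gksCoupling]
  -- identify the value at the end of the path and bound the value at its start from below
  have hr1 : gksExpect s K C (spinAt (⟨a, haΛ⟩ : ↥Λ)) = isingCorr G Λ β h .free {a} :=
    (isingCorr_singleton_eq_gksExpect G Λ β h .free haΛ).symm
  have hsp : spinAt (⟨a, haΛ⟩ : ↥Λ) = spinProduct (inVol Λ {a}) := by
    have hset : inVol Λ {a} = {⟨a, haΛ⟩} := by
      ext z
      simp only [mem_inVol, Finset.mem_singleton, Subtype.ext_iff]
    funext ω
    rw [hset, spinProduct, Finset.prod_singleton]
  have hr2 : isingCorr G Λ₁ β h .free {a} ≤ gksExpect s (cplOff K B) C (spinAt (⟨a, haΛ⟩ : ↥Λ)) := by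
    rw [isingCorr_free_eq_gksExpect_decoupled G h1 β h (Finset.singleton_subset_iff.2 ha), hsp]
    refine gksExpect_mono_of_abs_le s C ?_ _
    rintro (e | x) hi
    · have hnot : (Sum.inl e : Sym2 V ⊕ V) ∉ B := by
        intro hmem
        obtain ⟨x, _, hx⟩ := hmemB.1 hmem
        exact Sum.inr_ne_inl hx
      simp only [cplOff, hnot, if_false, hKdef, decoupledCoupling, gksCoupling,
        interactionEdges_free]
      split_ifs with h1e h2e h2e
      · rw [edgeCoeff_of_mem_edgesIn G _ h2e, mul_one, abs_of_nonneg hβ]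
      · exact absurd (edgesIn_mono G h1 h1e) h2e
      · rw [abs_zero, edgeCoeff_of_mem_edgesIn G _ h2e, mul_one]; exact hβ
      · rw [abs_zero]
    · by_cases hx1 : x ∈ Λ₁
      · have hnot : (Sum.inr x : Sym2 V ⊕ V) ∉ B := by
          intro hmem
          obtain ⟨y, hy, hyx⟩ := hmemB.1 hmem
          have hyx' : y = x := Sum.inr_injective hyx
          exact (Finset.mem_sdiff.1 hy).2 (hyx' ▸ hx1)
        simp only [cplOff, hnot, if_false, hKdef, decoupledCoupling, gksCoupling, hx1, if_true]
        rw [abs_of_nonneg (mul_nonneg hβ hh)]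
      · simp only [decoupledCoupling, hx1, if_false, abs_zero, cplOff, hKdef, gksCoupling]
        split_ifs
        · exact le_rfl
        · exact mul_nonneg hβ hh
  rw [hl, hr1] at hmain
  linarith

end Ising

/-! ## Consequences on `ℤ^d`: the discharge -/

section Zd

variable {d : ℕ}

/-- **The correcting term against the increment of the magnetisation.** For finite volumes
`0 ∈ Λ₁ ⊆ Λ ⊂ ℤ^d` such that every neighbour of a site of `Λ₁` lies in `Λ`, `β > 0` and `h > 0`
(Duminil-Copin–Tassion's parametrisation),
`ε(Λ,β,h) ≤ (4d/h) (⟨σ₀⟩_{Λ,β,h} - ⟨σ₀⟩_{Λ₁,β,h})`: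
only the sites of `Λ ∖ Λ₁` have neighbours outside `Λ`, at most `2d` of them, the truncated
functions are nonnegative (GKS II), and `mul_sum_trunc_sdiff_le_isingCorr_sub` (GHS) bounds
`h ∑_{x ∈ Λ∖Λ₁} ⟨σ₀;σ_x⟩_{Λ,β,h}` by the increment of the magnetisation. [cite: DuminilCopinTassionCMP2016, Correction CMP 359 (2018) 821 (ε(Λ,β,h) → 0 by the GHS inequality)] [cite: Lebowitz1974, §2, Remark (ii) following the proof of the Theorem] -/
theorem dctBoundaryError_le_dctMag_sub {Λ₁ Λ : Finset (Site d)} (h1 : Λ₁ ⊆ Λ)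
    (h0 : (0 : Site d) ∈ Λ₁) (hnb : ∀ x ∈ Λ₁, ∀ y, (zdGraph d).Adj x y → y ∈ Λ) {β h : ℝ}
    (hβ : 0 < β) (hh : 0 < h) :
    dctBoundaryError d Λ β h ≤ 4 * d / h * (dctMag d Λ β h - dctMag d Λ₁ β h) := by
  have hk : 0 ≤ h / β := (div_pos hh hβ).le
  have ht0 : ∀ x ∈ Λ, 0 ≤ dctCorr d Λ β h ({0} ∆ {x}) - dctMag d Λ β h * dctCorr d Λ β h {x} :=
    fun x hx => dctCorr_trunc_nonneg (h1 h0) hx hβ.le hh.le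
  -- the GHS step
  have hghs : h * ∑ x ∈ Λ \ Λ₁, (dctCorr d Λ β h ({0} ∆ {x}) - dctMag d Λ β h * dctCorr d Λ β h {x}) ≤
      dctMag d Λ β h - dctMag d Λ₁ β h := by
    have hb := mul_sum_trunc_sdiff_le_isingCorr_sub (zdGraph d) h1 hβ.le hk h0
    rw [mul_div_cancel₀ _ hβ.ne'] at hb
    simpa only [dctMag, dctCorr] using hb
  -- the combinatorial step: only `Λ ∖ Λ₁` contributes, with multiplicity at most `2d`
  have hzero : ∑ x ∈ Λ₁, ∑ _y ∈ ((zdGraph d).neighborFinset x).filter (fun y => y ∉ Λ),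
      (dctCorr d Λ β h ({0} ∆ {x}) - dctMag d Λ β h * dctCorr d Λ β h {x}) = 0 := by
    refine Finset.sum_eq_zero fun x hx1 => ?_
    have hempty : ((zdGraph d).neighborFinset x).filter (fun y => y ∉ Λ) = ∅ := by
      refine Finset.filter_eq_empty_iff.2 fun y hy => ?_
      rw [SimpleGraph.mem_neighborFinset] at hy
      exact not_not.2 (hnb x hx1 y hy)
    rw [hempty, Finset.sum_empty]
  have hbdry : ∑ x ∈ Λ \ Λ₁, ∑ _y ∈ ((zdGraph d).neighborFinset x).filter (fun y => y ∉ Λ),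
        (dctCorr d Λ β h ({0} ∆ {x}) - dctMag d Λ β h * dctCorr d Λ β h {x}) ≤
      ∑ x ∈ Λ \ Λ₁, 2 * d * (dctCorr d Λ β h ({0} ∆ {x}) - dctMag d Λ β h * dctCorr d Λ β h {x}) := by
    refine Finset.sum_le_sum fun x hx => ?_
    rw [Finset.sum_const, nsmul_eq_mul]
    refine mul_le_mul_of_nonneg_right ?_ (ht0 x (Finset.mem_sdiff.1 hx).1)
    exact_mod_cast (Finset.card_filter_le _ _).trans (card_neighborFinset_zdGraph_le x)
  have hsplit := (Finset.sum_sdiff h1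
    (f := fun x => ∑ _y ∈ ((zdGraph d).neighborFinset x).filter (fun y => y ∉ Λ),
      (dctCorr d Λ β h ({0} ∆ {x}) - dctMag d Λ β h * dctCorr d Λ β h {x}))).symm
  have hd0 : (0 : ℝ) ≤ 4 * d / h := by positivity
  unfold dctBoundaryError
  rw [hsplit, hzero, add_zero]
  calc 2 * ∑ x ∈ Λ \ Λ₁, ∑ _y ∈ ((zdGraph d).neighborFinset x).filter (fun y => y ∉ Λ),
          (dctCorr d Λ β h ({0} ∆ {x}) - dctMag d Λ β h * dctCorr d Λ β h {x})
      ≤ 2 * ∑ x ∈ Λ \ Λ₁, 2 * d *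
          (dctCorr d Λ β h ({0} ∆ {x}) - dctMag d Λ β h * dctCorr d Λ β h {x}) :=
        mul_le_mul_of_nonneg_left hbdry zero_le_two
    _ = 4 * d / h * (h * ∑ x ∈ Λ \ Λ₁,
          (dctCorr d Λ β h ({0} ∆ {x}) - dctMag d Λ β h * dctCorr d Λ β h {x})) := by
        rw [← Finset.mul_sum]
        field_simp
        ring
    _ ≤ 4 * d / h * (dctMag d Λ β h - dctMag d Λ₁ β h) := mul_le_mul_of_nonneg_left hghs hd0

/-- **`ε(Λ_{n+1},β,h) ≤ (4d/h)(⟨σ₀⟩_{Λ_{n+1},β,h} - ⟨σ₀⟩_{Λ_n,β,h})`** for the boxes of `ℤ^d`,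
`β > 0`, `h > 0` (the sites of `Λ_n` have all their neighbours in `Λ_{n+1}`: `‖y‖_∞ ≤ ‖x‖_∞ + 1`
for `x ∼ y`, `Site.supNorm_le_succ_of_adj`). [cite: DuminilCopinTassionCMP2016, Correction CMP 359 (2018) 821 (ε(Λ,β,h) → 0 by the GHS inequality)] -/
theorem dctBoundaryError_box_succ_le (n : ℕ) {β h : ℝ} (hβ : 0 < β) (hh : 0 < h) :
    dctBoundaryError d (box d (n + 1)) β h ≤
      4 * d / h * (dctMag d (box d (n + 1)) β h - dctMag d (box d n) β h) := by
  refine dctBoundaryError_le_dctMag_sub (box_mono d (Nat.le_succ n)) (zero_mem_box d n)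
    (fun x hx y hxy => ?_) hβ hh
  rw [mem_box_iff_supNorm_le] at hx ⊢
  have hsucc := Site.supNorm_le_succ_of_adj hxy
  omega

/-- **Discharge of `dct_boundaryError_tendsto_zero`** (Duminil-Copin–Tassion, Correction
CMP 359 (2018) 821: "the GHS inequality [GHS70] classically implies that `ε(Λ,β,h)` tends to `0`
as `Λ` tends to `V`"): for the nearest-neighbour Ising model on `ℤ^d`, `d ≥ 1`, `β > 0`, `h > 0`,
`ε(Λ_n,β,h) → 0` along the boxes `Λ_n = [-n,n]^d`. By `dctBoundaryError_box_succ_le` and GKS II,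
`0 ≤ ε(Λ_{n+1},β,h) ≤ (4d/h)(⟨σ₀⟩_{Λ_{n+1},β,h} - ⟨σ₀⟩_{Λ_n,β,h})`, and the finite-volume
magnetisations converge (`tendsto_dctMag_box`, existence of the free state). [cite: DuminilCopinTassionCMP2016, Correction CMP 359 (2018) 821 (ε(Λ,β,h) → 0 by the GHS inequality)] [cite: GriffithsHurstSherman1970, Thm. 1] -/
theorem dct_boundaryError_tendsto_zero_holds : dct_boundaryError_tendsto_zero (d := d) := by
  intro _ β h hβ hh
  have hM := tendsto_dctMag_box (d := d) hβ hh.le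
  -- the increments of the magnetisation tend to `0`
  have hinc : Tendsto (fun n : ℕ =>
      4 * d / h * (dctMag d (box d (n + 1)) β h - dctMag d (box d n) β h)) atTop (𝓝 0) := by
    have h1 : Tendsto (fun n : ℕ => dctMag d (box d (n + 1)) β h) atTop (𝓝 (dctMagInf d β h)) :=
      hM.comp (tendsto_add_atTop_nat 1)
    have h2 := (h1.sub hM).const_mul (4 * d / h)
    simpa using h2
  -- squeeze the shifted sequence
  have hshift : Tendsto (fun n : ℕ => dctBoundaryError d (box d (n + 1)) β h) atTop (𝓝 0) :=
    tendsto_of_tendsto_of_tendsto_of_le_of_le tendsto_const_nhds hinc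
      (fun n => dctBoundaryError_nonneg (zero_mem_box d (n + 1)) hβ.le hh.le)
      (fun n => dctBoundaryError_box_succ_le n hβ hh)
  exact (tendsto_add_atTop_iff_nat 1).1 hshift

end Zd

/-! ## `lim_{h ↘ 0} ⟨σ₀⟩^∅_{β,h} = m*(β)`: the discharge of the fourth named fact of
`MeanFieldLowerBound` -/

section FreeMagnetisationLimit

variable {d : ℕ}

/-- **Discharge of `freeCorr_singleton_tendsto_spontaneousMagnetization`** (Friedli–Velenik 2017,
Remark 3.30, p. 118: "considering a sequence `h ↓ 0` …
`m*(β) = lim_{h↓0} m(β,h) = lim_{h↓0} m⁺(β,h) = m⁺(β,0) = ⟨σ₀⟩⁺_{β,0}`", with Prop. 3.29 and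
Lemma 3.31 (1), p. 119 ("`h ↦ ⟨σ₀⟩⁺_{β,h}` is nondecreasing and right-continuous") and Thm. 3.25
(1), p. 116 ("when `h ≠ 0`, there is a unique Gibbs state for all values of `β ∈ ℝ_{≥0}`")): for
the nearest-neighbour Ising model on `ℤ^d`, `d ≥ 1`, and `β ≥ 0`, the free-state magnetisation
`⟨σ₀⟩^∅_{β,h}` (`freeCorr d β h {0}`, tree parametrisation of the field) tends to the spontaneous
magnetisation `m*(β) = ⟨σ₀⟩⁺_{β,0}` as `h ↘ 0`. The tree proof follows the printed architecture:
the right-continuity of `h ↦ ⟨σ₀⟩⁺_{β,h}` at `h = 0` is `plusCorr_continuousWithinAt_Ici_field`,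
the identification `⟨σ₀⟩^∅_{β,h} = ⟨σ₀⟩⁺_{β,h}` for `h > 0` (Thm. 3.25 (1) for the one-point
function, the named fact `freeCorr_eq_plusCorr_singleton_of_pos`) is obtained along the GHS route
of Friedli–Velenik's Remark 3.41 — here as `freeCorr_eq_plusCorr_singleton_of_pos_of_boundaryError`
(`0 ≤ ⟨σ₀⟩⁺_{Λ_L} - ⟨σ₀⟩^∅_{Λ_L} ≤ (β/2) ε(Λ_L,β,βh)`, `MeanFieldBoundGHS`) fed with
`dct_boundaryError_tendsto_zero_holds` above — and the two are assembled by
`freeCorr_singleton_tendsto_spontaneousMagnetization_of_uniqueness` (`MeanFieldLowerBound`), i.e.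
by `freeCorr_singleton_tendsto_spontaneousMagnetization_of_boundaryError`. [cite: FriedliVelenik2017, Remark 3.30, p. 118, with Prop. 3.29 and Lemma 3.31 (1) (p. 119) and Thm. 3.25 (1) (p. 116)] -/
theorem freeCorr_singleton_tendsto_spontaneousMagnetization_holds :
    freeCorr_singleton_tendsto_spontaneousMagnetization (d := d) :=
  freeCorr_singleton_tendsto_spontaneousMagnetization_of_boundaryError
    dct_boundaryError_tendsto_zero_holds

end FreeMagnetisationLimit

end Literature.Probability.LatticeModels
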